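import Summits.Ventures.HodgeRepro.QuadEngine
import Summits.Ventures.HodgeRepro.FaceCensusRows12

/-!
# Degree 12: the check on the SEALED census tables

Blind re-derivation cell `pub-hodge-repro`, seat `typer` (gen 5).  The check `noSingleClassSumTwo`
of `QuadEngine.lean` evaluated by kernel `decide` on the four Cayley tables of the sealed degree-12
census rows themselves (`FaceCensusRows12.lean`: `Duodecic.Cyclic.Γ`, `Duodecic.C6C2.Γ`,
`Duodecic.Dihedral.Γ`, `Duodecic.Dicyclic.Γ`).  With `QuadEngine.hasConjPair_of_sumTwo`: in the
sealed vocabulary, every `SumTwo` quadruple `[T, T·a, T·b, T·d]` of twists of a CM type `T` of such a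
table has two conjugate corners — the single-class claim of ROUTE.md §3.4 for every pairing pattern,
on the objects the sealed census is about.  (The typer tables: `QuadRows12.lean`.)
-/

set_option autoImplicit false

open Summit.Ventures.HodgeRepro.FaceCensus

namespace HodgeRepro.QuadEngine

/-- Sealed `C₁₂` table: the check passes (kernel `decide`). -/
theorem noSingleClassSumTwo_sealed_Cyclic : noSingleClassSumTwo Duodecic.Cyclic.Γ = true := by
  decide +kernel

/-- Sealed `C₆ × C₂` table: the check passes. -/
theorem noSingleClassSumTwo_sealed_C6C2 : noSingleClassSumTwo Duodecic.C6C2.Γ = true := by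
  decide +kernel

/-- Sealed `D₆` table: the check passes. -/
theorem noSingleClassSumTwo_sealed_Dihedral : noSingleClassSumTwo Duodecic.Dihedral.Γ = true := by
  decide +kernel

/-- Sealed `Dic₃` table: the check passes. -/
theorem noSingleClassSumTwo_sealed_Dicyclic : noSingleClassSumTwo Duodecic.Dicyclic.Γ = true := by
  decide +kernel

end HodgeRepro.QuadEngine
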